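import Literature.Probability.LatticeModels.GarbanSpencerXYLongRangeOrder
import Literature.Probability.LatticeModels.SphereCircleBridge
import Literature.Probability.LatticeModels.NishimoriPathEstimator
import Literature.Probability.LatticeModels.BallPathOverlap
import Mathlib.Analysis.Complex.ExponentialBounds
import HarnessLib

/-!
# Proof of `GarbanSpencer2022_xyLongRangeOrder`

C. Garban, T. Spencer, *Continuous symmetry breaking along the Nishimori line*, J. Math. Phys.
**63** (2022) 093302 = arXiv:2109.01617, Theorem 1.3 with Remark 1: long-range order of the
classical XY model in `d ≥ 3`, free boundary condition, arbitrary finite domains.  This file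
assembles the tree's formalisation of the printed proof:

1. `SphereCircleBridge`: the `O(2)` two-point function of `ONModel` is the XY correlation
   `⟨cos(θ_x − θ_y)⟩_{1,β}` of the bond system `latticeBonds Λ` on the torus `U(1)^Λ`.
2. `NishimoriPathEstimator` (Nishimori gauge identity, path identity (2.8), estimator (2.9)–(2.10),
   Lemma 2.5, and the Messager–Miracle-Solé–Pfister inequality of Remark 1): for every path
   ensemble, `1 − ⟨cos(θ_x − θ_y)⟩_{1,β} ≤ (∑ w w' λ^{-2·overlap} − 1)^{1/2}`.
3. `BallPathGeometry` / `BallPathOverlap` / `UnpredictablePairTails` (Step 2 and Theorem 2.4 of the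
   source, with the tree's explicit unpredictable walks): for `x ≠ y` the uniform ensemble of ball
   paths `verts ω`, `ω ∈ PEnv T T`, lies in `B((x+y)/2, 2‖x−y‖) ⊂ Λ`, consists of simple
   nearest-neighbour paths from `x` to `y`, and the overlap of two of them is `≤ 2(d+2)` times a
   number of near-meetings whose tail is `(1/2)^{⌊(k−1)/L⌋}` uniformly.
4. `VonMisesMoments`: `λ^{-2} ≤ (1 + 2/β)²`.

The exponential tail is converted into the moment bound `𝔼[ρ^N] ≤ 1 + 6L(ρ − 1)` for
`ρ^L ≤ 3/2` (`sum_pow_le_of_tails`), and the constants are `a = 96(d+2)L`, `β_c = 32(d+2)L`.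

## References

* C. Garban, T. Spencer, J. Math. Phys. 63 (2022) 093302, arXiv:2109.01617: Theorem 1.3,
  Remark 1, Lemma 2.5, proof of Theorem 1.3 Steps 1–2. [GarbanSpencer2022]
-/

noncomputable section

open MeasureTheory Finset
open scoped BigOperators

namespace Literature.Probability.LatticeModels

open BallPath DyadicWalk Trail

/-! ### From exponential tails to a moment bound -/

/-- `∑_{n < M} ρⁿ (1/2)^{⌊n/L⌋} ≤ 6L` for `1 ≤ ρ`, `ρ^L ≤ 3/2`. [folklore] -/
theorem sum_pow_mul_half_pow_div_le {L : ℕ} (hL : 1 ≤ L) {ρ : ℝ} (hρ1 : 1 ≤ ρ) (hρL : ρ ^ L ≤ 3 / 2) (M : ℕ) :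
    ∑ n ∈ Finset.range M, ρ ^ n * (1 / 2 : ℝ) ^ (n / L) ≤ 6 * L := by
  classical
  have hρ0 : 0 ≤ ρ := zero_le_one.trans hρ1
  -- termwise: ρ^n ≤ (ρ^L)^{n/L} ρ^L ≤ (3/2)^{n/L+1}
  have hterm : ∀ n, ρ ^ n * (1 / 2 : ℝ) ^ (n / L) ≤ (3 / 2) * (3 / 4 : ℝ) ^ (n / L) := by
    intro n
    have hn : n = L * (n / L) + n % L := (Nat.div_add_mod n L).symm
    have h1 : ρ ^ n ≤ (3 / 2 : ℝ) ^ (n / L) * (3 / 2) := by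
      calc ρ ^ n = (ρ ^ L) ^ (n / L) * ρ ^ (n % L) := by
            conv_lhs => rw [hn]
            rw [pow_add, pow_mul]
        _ ≤ (ρ ^ L) ^ (n / L) * ρ ^ L := by
            refine mul_le_mul_of_nonneg_left (pow_le_pow_right₀ hρ1 (Nat.mod_lt n (by omega)).le) (by positivity)
        _ ≤ (3 / 2 : ℝ) ^ (n / L) * (3 / 2) :=
            mul_le_mul (pow_le_pow_left₀ (by positivity) hρL _) hρL (by positivity) (by positivity)
    calc ρ ^ n * (1 / 2 : ℝ) ^ (n / L) ≤ ((3 / 2 : ℝ) ^ (n / L) * (3 / 2)) * (1 / 2 : ℝ) ^ (n / L) :=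
          mul_le_mul_of_nonneg_right h1 (by positivity)
      _ = (3 / 2) * (3 / 4 : ℝ) ^ (n / L) := by
          rw [show (3 / 4 : ℝ) = 3 / 2 * (1 / 2) by norm_num, mul_pow]; ring
  -- regroup by `q = n / L` (at most `L` values of `n` per `q`)
  have hfib : ∀ q, #{n ∈ Finset.range M | n / L = q} ≤ L := by
    intro q
    have : ({n ∈ Finset.range M | n / L = q}) ⊆ Finset.Ico (L * q) (L * q + L) := by
      intro n hn
      rw [Finset.mem_filter] at hn
      rw [Finset.mem_Ico]
      have := Nat.div_add_mod n L
      have h2 := Nat.mod_lt n (show 0 < L by omega)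
      rw [hn.2] at this
      generalize L * q = P at this ⊢
      omega
    refine (Finset.card_le_card this).trans ?_
    simp
  calc ∑ n ∈ Finset.range M, ρ ^ n * (1 / 2 : ℝ) ^ (n / L)
      ≤ ∑ n ∈ Finset.range M, (3 / 2) * (3 / 4 : ℝ) ^ (n / L) := Finset.sum_le_sum fun n _ => hterm n
    _ = ∑ q ∈ (Finset.range M).image (· / L), #{n ∈ Finset.range M | n / L = q} • ((3 / 2) * (3 / 4 : ℝ) ^ q) :=
        Finset.sum_comp (fun q => (3 / 2) * (3 / 4 : ℝ) ^ q) (· / L)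
    _ ≤ ∑ q ∈ (Finset.range M).image (· / L), (L : ℝ) * ((3 / 2) * (3 / 4 : ℝ) ^ q) := by
        refine Finset.sum_le_sum fun q _ => ?_
        rw [nsmul_eq_mul]
        exact mul_le_mul_of_nonneg_right (by exact_mod_cast hfib q) (by positivity)
    _ ≤ ∑ q ∈ Finset.range M, (L : ℝ) * ((3 / 2) * (3 / 4 : ℝ) ^ q) := by
        refine Finset.sum_le_sum_of_subset_of_nonneg (fun q hq => ?_) fun q _ _ => by positivity
        rw [Finset.mem_image] at hq
        obtain ⟨n, hn, rfl⟩ := hq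
        rw [Finset.mem_range] at hn ⊢
        exact lt_of_le_of_lt (Nat.div_le_self n L) hn
    _ = (L : ℝ) * (3 / 2) * ∑ q ∈ Finset.range M, (3 / 4 : ℝ) ^ q := by
        rw [Finset.mul_sum]; refine Finset.sum_congr rfl fun q _ => by ring
    _ ≤ (L : ℝ) * (3 / 2) * 4 := by
        refine mul_le_mul_of_nonneg_left ?_ (by positivity)
        have := geom_sum_Ico_le_of_lt_one (m := 0) (n := M) (x := (3 / 4 : ℝ)) (by norm_num) (by norm_num)
        rw [Finset.range_eq_Ico]
        refine this.trans ?_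
        norm_num
    _ = 6 * L := by ring

open Classical in
/-- **From exponential tails to a moment bound.** If `#{N ≥ k} ≤ (1/2)^{⌊(k−1)/L⌋} #Ω` for all
`k`, then `∑_ω ρ^{N ω} ≤ (1 + 6L(ρ − 1)) #Ω` whenever `1 ≤ ρ` and `ρ^L ≤ 3/2` (Abel summation).
[folklore] -/
theorem sum_pow_le_of_tails {Ω : Type*} [Fintype Ω] (N : Ω → ℕ) {L : ℕ} (hL : 1 ≤ L)
    (htail : ∀ k : ℕ, (#{ω : Ω | k ≤ N ω} : ℝ) ≤ (1 / 2 : ℝ) ^ ((k - 1) / L) * Fintype.card Ω)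
    {ρ : ℝ} (hρ1 : 1 ≤ ρ) (hρL : ρ ^ L ≤ 3 / 2) :
    ∑ ω, ρ ^ N ω ≤ (1 + 6 * L * (ρ - 1)) * Fintype.card Ω := by
  -- a uniform bound on `N`
  obtain ⟨M, hM⟩ : ∃ M, ∀ ω, N ω < M := by
    rcases isEmpty_or_nonempty Ω with h | h
    · exact ⟨0, fun ω => (IsEmpty.false ω).elim⟩
    · exact ⟨(Finset.univ.image N).max' (Finset.univ_nonempty.image N) + 1, fun ω =>
        Nat.lt_succ_of_le (Finset.le_max' _ _ (Finset.mem_image_of_mem N (Finset.mem_univ ω)))⟩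
  -- Abel summation: `ρ^N = 1 + (ρ − 1) ∑_{n < M} [n < N] ρ^n`
  have habel : ∀ ω, ρ ^ N ω = 1 + (ρ - 1) * ∑ n ∈ Finset.range M, (if n < N ω then ρ ^ n else 0) := by
    intro ω
    have h := geom_sum_mul ρ (N ω)
    have e : ∑ n ∈ Finset.range M, (if n < N ω then ρ ^ n else 0) = ∑ n ∈ Finset.range (N ω), ρ ^ n := by
      rw [← Finset.sum_filter]
      congr 1
      ext n
      simp only [Finset.mem_filter, Finset.mem_range]
      constructor
      · exact fun h => h.2
      · exact fun h => ⟨h.trans (hM ω), h⟩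
    rw [e, mul_comm]
    linarith
  simp_rw [habel]
  rw [Finset.sum_add_distrib, Finset.sum_const, Finset.card_univ, nsmul_eq_mul, mul_one,
    ← Finset.mul_sum, Finset.sum_comm]
  -- `∑_ω [n < N ω] ρ^n = ρ^n #{N ≥ n+1}`
  have hcnt : ∀ n, ∑ ω, (if n < N ω then ρ ^ n else 0) = ρ ^ n * #{ω : Ω | n + 1 ≤ N ω} := by
    intro n
    rw [← Finset.sum_filter, Finset.sum_const, nsmul_eq_mul, mul_comm]
    congr 2
  simp_rw [hcnt]
  have hsum : ∑ n ∈ Finset.range M, ρ ^ n * (#{ω : Ω | n + 1 ≤ N ω} : ℝ) ≤ 6 * L * Fintype.card Ω := by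
    calc ∑ n ∈ Finset.range M, ρ ^ n * (#{ω : Ω | n + 1 ≤ N ω} : ℝ)
        ≤ ∑ n ∈ Finset.range M, ρ ^ n * ((1 / 2 : ℝ) ^ (n / L) * Fintype.card Ω) := by
          refine Finset.sum_le_sum fun n _ => mul_le_mul_of_nonneg_left ?_ (by positivity)
          have := htail (n + 1)
          simpa using this
      _ = (∑ n ∈ Finset.range M, ρ ^ n * (1 / 2 : ℝ) ^ (n / L)) * Fintype.card Ω := by
          rw [Finset.sum_mul]; refine Finset.sum_congr rfl fun n _ => by ring
      _ ≤ 6 * L * Fintype.card Ω :=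
          mul_le_mul_of_nonneg_right (sum_pow_mul_half_pow_div_le hL hρ1 hρL M) (by positivity)
  have hρ : 0 ≤ ρ - 1 := by linarith
  nlinarith [hsum, hρ]

/-! ### The ensemble of ball paths of a frame -/

namespace BallPath

section Ensemble

variable {d : ℕ} [MeasurableSpace Circle] [BorelSpace Circle]

omit [MeasurableSpace Circle] [BorelSpace Circle] in
/-- The vertices of a ball path lie in any `Λ` containing the ball `B((x+y)/2, 2‖x−y‖₂)`.
[cite: GarbanSpencer2022, proof of Theorem 1.3, Step 2 (the ball condition)] -/
theorem Frame.mem_of_mem_verts (F : Frame d) {Λ : Finset (Site d)}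
    (hball : ∀ z : Site d, (∑ i, ((z i : ℝ) - ((F.x i : ℝ) + (F.y i : ℝ)) / 2) ^ 2) ≤
      4 * ∑ i, ((F.x i : ℝ) - (F.y i : ℝ)) ^ 2 → z ∈ Λ)
    (ω : F.Rnd) : ∀ z ∈ F.verts ω, z ∈ Λ :=
  fun z hz => hball z (F.mem_ball_of_mem_verts ω hz)

omit [MeasurableSpace Circle] [BorelSpace Circle] in
/-- The unit chain (from `x` to `y`, on the bond system of `Λ`) of the ball path `verts ω`.
[cite: GarbanSpencer2022, proof of Theorem 1.3, Steps 1–2] -/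
def Frame.chainOf (F : Frame d) {Λ : Finset (Site d)} (hx : F.x ∈ Λ) (hy : F.y ∈ Λ)
    (hball : ∀ z : Site d, (∑ i, ((z i : ℝ) - ((F.x i : ℝ) + (F.y i : ℝ)) / 2) ^ 2) ≤
      4 * ∑ i, ((F.x i : ℝ) - (F.y i : ℝ)) ^ 2 → z ∈ Λ)
    (ω : F.Rnd) : (latticeBonds Λ).UnitChain (⟨F.x, hx⟩ : ↥Λ) ⟨F.y, hy⟩ :=
  unitChainOf Λ (F.isChain_verts ω) (F.nodup_verts ω) (F.mem_of_mem_verts hball ω) (List.cons_ne_nil _ _)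
    rfl (F.getLast_verts ω)

omit [MeasurableSpace Circle] [BorelSpace Circle] in
/-- **The overlap of two ball-path chains is controlled by near-meetings**:
`overlap ≤ 2(d+2) · #{τ ≤ T : near-meeting}`. [cite: GarbanSpencer2022, Lemma 2.5 with Theorem 2.4] -/
theorem Frame.overlap_chainOf_le (F : Frame d) {Λ : Finset (Site d)} (hx : F.x ∈ Λ) (hy : F.y ∈ Λ)
    (hball : ∀ z : Site d, (∑ i, ((z i : ℝ) - ((F.x i : ℝ) + (F.y i : ℝ)) / 2) ^ 2) ≤
      4 * ∑ i, ((F.x i : ℝ) - (F.y i : ℝ)) ^ 2 → z ∈ Λ) (ω ω' : F.Rnd) :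
    (F.chainOf hx hy hball ω).overlap (F.chainOf hx hy hball ω') ≤
      2 * (d + 2) * meetCount (M F.T F.T) 0 (F.T + 1) ((ω, ω') : Pair F.T F.T) :=
  (overlap_unitChainOf_le Λ _ _ _ _ _ _ _ _ _ _ _ _).trans (F.card_commonEdges_le ω ω')

end Ensemble

end BallPath

/-! ### The theorem -/

/-- Elementary: `(1 + 2/β)^n ≤ 1 + 4n/β` as soon as `2n ≤ β` (via `(1+t)^n ≤ e^{nt} ≤ 1 + 2nt`).
[folklore] -/
theorem one_add_two_div_pow_le {β : ℝ} {n : ℕ} (hβ : 0 < β) (hn : 2 * (n : ℝ) ≤ β) :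
    (1 + 2 / β) ^ n ≤ 1 + 4 * n / β := by
  have h1 : (1 + 2 / β) ^ n ≤ Real.exp (n * (2 / β)) := by
    rw [Real.exp_nat_mul]
    exact pow_le_pow_left₀ (by positivity) (by have := Real.add_one_le_exp (2 / β); linarith) n
  have h2 : |(n : ℝ) * (2 / β)| ≤ 1 := by
    rw [abs_of_nonneg (by positivity), mul_div_assoc', div_le_one hβ]; linarith
  have h3 := Real.abs_exp_sub_one_le h2
  rw [abs_of_nonneg (by positivity : (0 : ℝ) ≤ (n : ℝ) * (2 / β))] at h3
  have h4 : Real.exp ((n : ℝ) * (2 / β)) ≤ 1 + 2 * ((n : ℝ) * (2 / β)) := by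
    have := (abs_le.1 h3).2; linarith
  calc (1 + 2 / β) ^ n ≤ Real.exp (n * (2 / β)) := h1
    _ ≤ 1 + 2 * ((n : ℝ) * (2 / β)) := h4
    _ = 1 + 4 * n / β := by ring

/-- **Garban–Spencer 2022, Theorem 1.3 with Remark 1** (discharge of the tree's named fact
`GarbanSpencer2022_xyLongRangeOrder`): long-range order of the classical XY model in `d ≥ 3`,
free boundary condition, every finite `Λ ⊂ ℤ^d` and every pair of points whose ball
`B((x+y)/2, 2‖x−y‖₂)` lies in `Λ`. [cite: GarbanSpencer2022, Theorem 1.3 with Remark 1] -/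
theorem GarbanSpencer2022_xyLongRangeOrder_holds : GarbanSpencer2022_xyLongRangeOrder := by
  letI : MeasurableSpace Circle := borel Circle
  haveI : BorelSpace Circle := ⟨rfl⟩
  intro d hd
  obtain ⟨L, hL, htail⟩ := card_meetCount_ge_le
  -- constants
  set c : ℕ := 2 * (d + 2) with hc
  have hc1 : (1 : ℝ) ≤ c := by rw [hc]; push_cast; linarith [show (0:ℝ) ≤ d from Nat.cast_nonneg d]
  have hL1 : (1 : ℝ) ≤ L := by exact_mod_cast hL
  refine ⟨16 * c * L, 48 * c * L, by positivity, by positivity, ?_⟩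
  intro β hβ Λ x y hx hy hball
  have hβ0 : 0 < β := lt_of_lt_of_le (by positivity) hβ
  have hβ16 : (16 : ℝ) ≤ β := le_trans (by nlinarith) hβ
  -- the trivial case `x = y`
  by_cases hne : x = y
  · subst hne
    rw [onTwoPoint_self]
    linarith [Real.sqrt_nonneg (48 * c * L * Real.log β / β)]
  -- frame and ensemble
  obtain ⟨F, rfl, rfl⟩ := Frame.exists_of_ne hd hne
  set G := latticeBonds Λ with hG
  set T : F.Rnd → G.UnitChain (⟨F.x, hx⟩ : ↥Λ) ⟨F.y, hy⟩ := F.chainOf hx hy hball with hT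
  set w : F.Rnd → ℝ := fun _ => (Fintype.card F.Rnd : ℝ)⁻¹ with hw
  haveI : Nonempty F.Rnd := ⟨fun _ => 0⟩
  have hcard : (0 : ℝ) < Fintype.card F.Rnd := by exact_mod_cast Fintype.card_pos
  have hw0 : ∀ s, 0 ≤ w s := fun _ => by positivity
  have hw1 : ∑ s, w s = 1 := by
    rw [hw, Finset.sum_const, Finset.card_univ, nsmul_eq_mul, mul_inv_cancel₀ hcard.ne']
  -- the deterministic estimate
  have hest := G.one_sub_expect_one_cosDiff_le hβ0 (⟨F.x, hx⟩ : ↥Λ) ⟨F.y, hy⟩ w hw0 hw1 T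
  rw [onTwoPoint_onMeasure_two_eq_expect Λ β hx hy]
  -- `κ = λ^{-2}`, `ρ = κ^c`
  set lam := vonMisesMean β with hlam
  have hlam0 : 0 < lam := vonMisesMean_pos hβ0
  have hlam1 : lam ≤ 1 := vonMisesMean_le_one hβ0
  set κ : ℝ := (lam ^ 2)⁻¹ with hκ
  have hκ1 : 1 ≤ κ := by
    rw [hκ, one_le_inv₀ (by positivity)]; exact pow_le_one₀ hlam0.le hlam1
  have hκle : κ ≤ (1 + 2 / β) ^ 2 := by
    have h := inv_vonMisesMean_le hβ0
    rw [hκ, ← inv_pow]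
    exact pow_le_pow_left₀ (by positivity) h 2
  set ρ : ℝ := κ ^ c with hρ
  have hρ1 : 1 ≤ ρ := one_le_pow₀ hκ1
  have hcβ : 2 * ((2 * c : ℕ) : ℝ) ≤ β := by push_cast; nlinarith
  have hcLβ : 2 * ((2 * c * L : ℕ) : ℝ) ≤ β := by push_cast; nlinarith
  have hρle : ρ ≤ 1 + 8 * c / β := by
    calc ρ ≤ ((1 + 2 / β) ^ 2) ^ c := pow_le_pow_left₀ (by positivity) hκle c
      _ = (1 + 2 / β) ^ (2 * c) := by rw [← pow_mul]
      _ ≤ 1 + 4 * ((2 * c : ℕ) : ℝ) / β := one_add_two_div_pow_le hβ0 hcβ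
      _ = 1 + 8 * c / β := by push_cast; ring
  have hρL : ρ ^ L ≤ 3 / 2 := by
    have h16 : 4 * ((2 * c * L : ℕ) : ℝ) / β ≤ 1 / 2 := by
      rw [div_le_iff₀ hβ0]; push_cast; nlinarith
    calc ρ ^ L ≤ (((1 + 2 / β) ^ 2) ^ c) ^ L :=
          pow_le_pow_left₀ (by positivity) (pow_le_pow_left₀ (by positivity) hκle c) L
      _ = (1 + 2 / β) ^ (2 * c * L) := by rw [← pow_mul, ← pow_mul]; simp only [hc]; ring_nf
      _ ≤ 1 + 4 * ((2 * c * L : ℕ) : ℝ) / β := one_add_two_div_pow_le hβ0 hcLβ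
      _ ≤ 3 / 2 := by linarith
  -- the overlap moment
  have hmom : ∑ s, ∑ s', w s * w s' * κ ^ (T s).overlap (T s') ≤ 1 + 6 * L * (ρ - 1) := by
    have hpair : ∀ s s', κ ^ (T s).overlap (T s') ≤
        ρ ^ meetCount (M F.T F.T) 0 (F.T + 1) ((s, s') : Pair F.T F.T) := by
      intro s s'
      rw [hρ, ← pow_mul]
      exact pow_le_pow_right₀ hκ1 (by rw [hT]; exact F.overlap_chainOf_le hx hy hball s s')
    have htail' := htail F.T F.T (Nat.lt_two_pow_self).le
    have hmgf := sum_pow_le_of_tails (fun p : Pair F.T F.T => meetCount (M F.T F.T) 0 (F.T + 1) p) hL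
      (fun k => by simpa [DyadicWalk.cnt] using htail' k) hρ1 hρL
    rw [Fintype.card_prod] at hmgf
    calc ∑ s, ∑ s', w s * w s' * κ ^ (T s).overlap (T s')
        ≤ ∑ s, ∑ s', w s * w s' * ρ ^ meetCount (M F.T F.T) 0 (F.T + 1) ((s, s') : Pair F.T F.T) :=
          Finset.sum_le_sum fun s _ => Finset.sum_le_sum fun s' _ =>
            mul_le_mul_of_nonneg_left (hpair s s') (mul_nonneg (hw0 s) (hw0 s'))
      _ = (Fintype.card F.Rnd : ℝ)⁻¹ ^ 2 * ∑ p : Pair F.T F.T, ρ ^ meetCount (M F.T F.T) 0 (F.T + 1) p := by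
          rw [Fintype.sum_prod_type, Finset.mul_sum]
          refine Finset.sum_congr rfl fun s _ => ?_
          rw [Finset.mul_sum]
          refine Finset.sum_congr rfl fun s' _ => ?_
          rw [hw]; ring
      _ ≤ (Fintype.card F.Rnd : ℝ)⁻¹ ^ 2 * ((1 + 6 * L * (ρ - 1)) * (Fintype.card F.Rnd * Fintype.card F.Rnd : ℕ)) :=
          mul_le_mul_of_nonneg_left hmgf (by positivity)
      _ = 1 + 6 * L * (ρ - 1) := by push_cast; field_simp
  -- conclusion
  have hfin : ∑ s, ∑ s', w s * w s' * κ ^ (T s).overlap (T s') - 1 ≤ 48 * c * L * Real.log β / β := by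
    have hlog : 1 ≤ Real.log β := by
      rw [← Real.log_exp 1]
      refine Real.log_le_log (Real.exp_pos 1) (le_trans ?_ hβ16)
      linarith [Real.exp_one_lt_three]
    calc ∑ s, ∑ s', w s * w s' * κ ^ (T s).overlap (T s') - 1 ≤ 6 * L * (ρ - 1) := by linarith
      _ ≤ 6 * L * (8 * c / β) := mul_le_mul_of_nonneg_left (by linarith) (by positivity)
      _ = 48 * c * L * 1 / β := by ring
      _ ≤ 48 * c * L * Real.log β / β := by gcongr
  have hsq := Real.sqrt_le_sqrt hfin
  linarith [hest]

end Literature.Probability.LatticeModels
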